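import Summits.AnomalousDissipation.AnomalousDissipation.Theorems.LimitingAbsorptionFloorUpgradeStubSourcedSolution
import Summits.AnomalousDissipation.AnomalousDissipation.Theorems.LimitingAbsorptionFloorUpgradeStubBoundedEnstrophyNoRelaxation
import Summits.AnomalousDissipation.AnomalousDissipation.Theses.LimitingAbsorption
import HarnessLib

/-!
# `FloorUpgrade` in the language of refuted strengthenings of `RelaxingFamily`
# (line `material-derivative-dichotomy`, crux stmt-AnomalousDissipation-15010)

Summit-side helper file (everything proved; supports stmt-AnomalousDissipation-15010). The crux
`LimitingAbsorption.FloorUpgrade := RelaxingFamily → UniformRelaxationWitness` is reduced to NEGATIVE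
statements about witnesses of crux r3 (`RelaxingFamily`, stmt-AnomalousDissipation-15009), in the exact
shape `¬ RelaxingFamilyUnder H` of the tree's catalogue `Theorems/RelaxingFamily/Negative/*`
(`RelaxingFamilyUnder H` = the crux r3 verbatim with one extra hypothesis `H g h ν v` on the witness):

* `floorUpgrade_of_not_relaxingFamilyUnder_noFloor` — **K1′ ⇒ crux**: if NO witness of r3 has vanishing
  absorbed power (`∀ ε > 0, ∀ᶠ j, limsup-mean ν_j‖∇θ_j‖² < ε` for its `h`-sourced weak scalars `θ_j` from
  zero datum, which exist globally by the landed `stub_sourcedSolution`), then `FloorUpgrade` holds — the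
  witness handed over by `RelaxingFamily` has a floor `ε > 0` at infinitely many levels, and the sub-family
  of those levels (every clause of r3 is inherited, `ν ∘ ψ → 0`) is a `UniformRelaxationWitness` built from
  the family's OWN data. This is the by-contradiction frame of the line's skeleton
  (`Cruxes/FloorUpgrade/Lines/material_derivative_dichotomy.lean`, `FloorUpgrade_of`) with its two open
  stubs abstracted into the class hypothesis.
* `orrTiltRigidity_iff_not_relaxingFamilyUnder` — the line's load-bearing stub S3′
  (`stub_orrTiltRigidity`: relaxing family + no floor + slow smooth transfer fields ⇒ bounded mean
  enstrophy at infinitely many levels) is EQUIVALENT to the emptiness of the class of r3-witnesses carrying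
  vanishing absorbed power AND slow smooth transfer fields: `⇒` by the landed Seis endgame
  `stub_boundedEnstrophyNoRelaxation` (bounded enstrophy frequently contradicts `(U_h)`), `⇐` vacuously.
  So S3′ is a pure non-existence statement about crux r3's class (no enstrophy bound need ever be produced).
* `relaxingFamilyUnder_slowTransfer_of_noFloor` — the line's stub S4 (`stub_slowTransferField`) maps the
  no-floor class into the no-floor-with-transfer class (along the sub-family it produces).
* `floorUpgrade_of_slowTransferField_of_orrTiltRigidity` — hence S4 ∧ S3′ ⇒ `FloorUpgrade` (the skeleton's
  composition, re-derived through the classes).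

No new definitions: the classes are written as explicit lambdas (as in
`RelaxingFamily.Negative.FrequentLevels`).
-/

set_option linter.dupNamespace false

noncomputable section

open MeasureTheory Set Filter Topology
open scoped ENNReal NNReal InnerProductSpace
open Literature.Analysis Literature.Analysis.FluidPDE Literature.Analysis.FluidPDE.Torus
open Summit.AnomalousDissipation.AnomalousDissipation.Theses.LimitingAbsorption
open Summit.AnomalousDissipation.AnomalousDissipation.Theorems.RelaxingFamily.Negative

namespace Summit.AnomalousDissipation.AnomalousDissipation.Theorems.FloorUpgradeMDD

/-! ## K1′ in class language implies the crux -/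

/-- **No relaxing family with vanishing absorbed power ⇒ `FloorUpgrade`.** If the class of witnesses of
crux r3 whose `h`-sourced weak scalars from zero datum have `limsup`-mean absorbed power `ν_j‖∇θ_j‖²`
tending to `0` along the whole index set is EMPTY, then `RelaxingFamily → UniformRelaxationWitness`: the
sourced scalars of the given family exist (`stub_sourcedSolution`), some `ε > 0` floors their absorbed
power at infinitely many levels (else the family would lie in the empty class), and extracting those levels
(`Filter.extraction_of_frequently_atTop`) gives X with the family's own `(g, h, ν∘ψ, v₀∘ψ, v∘ψ, E, C, γ)`.
[folklore] -/
theorem floorUpgrade_of_not_relaxingFamilyUnder_noFloor : (¬ Summit.AnomalousDissipation.AnomalousDissipation.Theorems.RelaxingFamily.Negative.RelaxingFamilyUnder fun _g h ν v => ∃ θ : ℕ → ℝ → UnitAddTorus (Fin 2) → ℝ, (∀ j, Literature.Analysis.FluidPDE.Torus.IsWeakScalarTransportForced (ν j) (v j) (fun _ => h) 0 (θ j)) ∧ ∀ ε : ℝ, 0 < ε → ∀ᶠ j in Filter.atTop, Literature.Analysis.FluidPDE.longTimeAvgSup (fun t => ν j * (Literature.Analysis.FluidPDE.Torus.eScalarGradNormSq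 (θ j t)).toReal) < ε) → Summit.AnomalousDissipation.AnomalousDissipation.Theses.LimitingAbsorption.FloorUpgrade := by
  intro hK
  rintro ⟨g, h, hg, hgdiv, hgmean, hh, hhmean, hh0, ν, v₀, v, hνpos, hνlim, hLH, hbd, ⟨E, hE⟩, C, γ,
    hC, hγ, hrelax⟩
  -- the `h`-sourced scalars of the family (zero datum, diffusivity `ν j`)
  choose θ hθ using fun j =>
    stub_sourcedSolution (ν j) (ν j) g h (v₀ j) (v j) (hνpos j) hh (hLH j) (hbd j)
  -- a floor at infinitely many levels, else the family lies in the empty class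
  have key : ∃ ε : ℝ, 0 < ε ∧ ∃ᶠ j in atTop,
      ε ≤ longTimeAvgSup (fun t => ν j * (eScalarGradNormSq (θ j t)).toReal) := by
    by_contra hcon
    refine hK ⟨g, h, hg, hgdiv, hgmean, hh, hhmean, hh0, ν, v₀, v, hνpos, hνlim, hLH, hbd, ⟨E, hE⟩,
      ⟨θ, hθ, fun ε hε => ?_⟩, C, γ, hC, hγ, hrelax⟩
    have h1 : ¬ ∃ᶠ j in atTop,
        ε ≤ longTimeAvgSup (fun t => ν j * (eScalarGradNormSq (θ j t)).toReal) :=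
      fun hf => hcon ⟨ε, hε, hf⟩
    simpa only [Filter.not_frequently, not_le] using h1
  -- extract the good levels: every clause of X is inherited
  obtain ⟨ε, hε, hfreq⟩ := key
  obtain ⟨ψ, hψ, hψP⟩ := Filter.extraction_of_frequently_atTop hfreq
  exact ⟨g, h, hg, hgdiv, hgmean, hh, hhmean, fun j => ν (ψ j), fun j => v₀ (ψ j),
    fun j => v (ψ j), fun j => hνpos (ψ j), hνlim.comp hψ.tendsto_atTop, fun j => hLH (ψ j),
    fun j => hbd (ψ j), ⟨E, fun j => hE (ψ j)⟩, ⟨C, γ, hC, hγ, fun j s hs => hrelax (ψ j) s hs⟩,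
    ε, hε, fun j => ⟨θ (ψ j), hθ (ψ j), hψP j⟩⟩

/-! ## The load-bearing stub S3′ is a non-existence statement about crux r3's class -/

/-- **S3′ ⟺ no relaxing family has vanishing absorbed power together with slow smooth transfer
fields.** The registered statement of `stub_orrTiltRigidity` (left) is equivalent to the emptiness of the
class of r3-witnesses admitting `h`-sourced scalars with no floor AND, for every `δ > 0`, `K(δ)`-bounded
jointly smooth transfer fields `χ_j` with mean-square material-derivative defect `≤ δ T` eventually
(right): `⇒` — a witness of the class would get bounded mean enstrophy at infinitely many levels from S3′,
which the landed Seis endgame `stub_boundedEnstrophyNoRelaxation` excludes under `(U_h)`; `⇐` — under the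
hypotheses of S3′ the data form a witness of the class, so the emptiness makes S3′ vacuous. [folklore] -/
theorem orrTiltRigidity_iff_not_relaxingFamilyUnder :
    (∀ (g : UnitAddTorus (Fin 2) → EuclideanSpace ℝ (Fin 2)) (h : UnitAddTorus (Fin 2) → ℝ) (ν : ℕ → ℝ)
        (v₀ : ℕ → UnitAddTorus (Fin 2) → EuclideanSpace ℝ (Fin 2))
        (v : ℕ → ℝ → UnitAddTorus (Fin 2) → EuclideanSpace ℝ (Fin 2)) (E C γ : ℝ),
        FunctionSpaces.Torus.IsSmooth g → FunctionSpaces.Torus.IsDivFree g →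
        FunctionSpaces.Torus.HasZeroMean g → FunctionSpaces.Torus.IsSmooth h →
        FunctionSpaces.Torus.HasZeroMean h → h ≠ 0 →
        (∀ j, 0 < ν j) → Tendsto ν atTop (𝓝 0) →
        (∀ j, IsGlobalLerayHopf (ν j) (fun _ => g) (v₀ j) (v j)) →
        (∀ (j : ℕ) (T : ℝ), 0 < T →
          MemLp (FunctionSpaces.Torus.stLift (v j)) ⊤ (volume.restrict (Ioo (0 : ℝ) T ×ˢ univ))) →
        (∀ j, meanEnergy (v j) ≤ E) → 0 ≤ C → 0 < γ →
        (∀ (j : ℕ) (s : ℝ), 0 ≤ s → ∀ (T : ℝ) (ϑ : ℝ → UnitAddTorus (Fin 2) → ℝ),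
          IsWeakScalarTransportOn T (ν j) (fun t => v j (s + t)) h ϑ →
            ∀ᵐ t ∂(volume.restrict (Ioo (0 : ℝ) T)),
              scalarL2Sq (ϑ t) ≤ C * Real.exp (-(γ * t)) * scalarL2Sq h) →
        ∀ (θ : ℕ → ℝ → UnitAddTorus (Fin 2) → ℝ),
        (∀ j, IsWeakScalarTransportForced (ν j) (v j) (fun _ => h) 0 (θ j)) →
        (∀ ε : ℝ, 0 < ε → ∀ᶠ j in atTop,
          longTimeAvgSup (fun t => ν j * (eScalarGradNormSq (θ j t)).toReal) < ε) →
        (∀ δ : ℝ, 0 < δ → ∃ (K : ℝ) (χ : ℕ → ℝ → UnitAddTorus (Fin 2) → ℝ),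
            (∀ j, FunctionSpaces.Torus.IsSmoothSpaceTimeOn (Ici (0 : ℝ)) (χ j)) ∧
            (∀ (j : ℕ) (t : ℝ), 0 ≤ t → ∀ x : UnitAddTorus (Fin 2),
              |χ j t x| ≤ K ∧ ‖FunctionSpaces.Torus.gradient (χ j t) x‖ ≤ K ∧
              (∀ i k : Fin 2,
                |FunctionSpaces.Torus.partialDeriv i (FunctionSpaces.Torus.partialDeriv k (χ j t)) x| ≤ K) ∧
              |FunctionSpaces.Torus.timeDerivWithin (Ici (0 : ℝ)) (χ j) t x| ≤ K ∧
              ‖FunctionSpaces.Torus.gradient (FunctionSpaces.Torus.timeDerivWithin (Ici (0 : ℝ)) (χ j) t) x‖ ≤ K) ∧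
            ∀ᶠ j in atTop, ∀ᶠ T in atTop,
              ∫⁻ t in Ioo (0 : ℝ) T, ∫⁻ x,
                  ‖h x - (FunctionSpaces.Torus.timeDerivWithin (Ici (0 : ℝ)) (χ j) t x +
                    ⟪v j t x, FunctionSpaces.Torus.gradient (χ j t) x⟫_ℝ)‖ₑ ^ 2
                ≤ ENNReal.ofReal (δ * T)) →
        ∃ Z : ℝ, ∃ᶠ j in atTop, ∀ᶠ T in atTop,
          ∫⁻ t in Ioo (0 : ℝ) T, FunctionSpaces.Torus.eGradNormSq (v j t) ≤ ENNReal.ofReal (Z * T)) ↔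
    ¬ RelaxingFamilyUnder fun _g h ν v =>
      ∃ θ : ℕ → ℝ → UnitAddTorus (Fin 2) → ℝ, (∀ j, IsWeakScalarTransportForced (ν j) (v j) (fun _ => h) 0 (θ j)) ∧
        (∀ ε : ℝ, 0 < ε → ∀ᶠ j in atTop,
          longTimeAvgSup (fun t => ν j * (eScalarGradNormSq (θ j t)).toReal) < ε) ∧
        (∀ δ : ℝ, 0 < δ → ∃ (K : ℝ) (χ : ℕ → ℝ → UnitAddTorus (Fin 2) → ℝ),
          (∀ j, FunctionSpaces.Torus.IsSmoothSpaceTimeOn (Ici (0 : ℝ)) (χ j)) ∧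
          (∀ (j : ℕ) (t : ℝ), 0 ≤ t → ∀ x : UnitAddTorus (Fin 2),
            |χ j t x| ≤ K ∧ ‖FunctionSpaces.Torus.gradient (χ j t) x‖ ≤ K ∧
            (∀ i k : Fin 2,
              |FunctionSpaces.Torus.partialDeriv i (FunctionSpaces.Torus.partialDeriv k (χ j t)) x| ≤ K) ∧
            |FunctionSpaces.Torus.timeDerivWithin (Ici (0 : ℝ)) (χ j) t x| ≤ K ∧
            ‖FunctionSpaces.Torus.gradient (FunctionSpaces.Torus.timeDerivWithin (Ici (0 : ℝ)) (χ j) t) x‖ ≤ K) ∧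
          ∀ᶠ j in atTop, ∀ᶠ T in atTop,
            ∫⁻ t in Ioo (0 : ℝ) T, ∫⁻ x,
                ‖h x - (FunctionSpaces.Torus.timeDerivWithin (Ici (0 : ℝ)) (χ j) t x +
                  ⟪v j t x, FunctionSpaces.Torus.gradient (χ j t) x⟫_ℝ)‖ₑ ^ 2
              ≤ ENNReal.ofReal (δ * T)) := by
  constructor
  · rintro hS ⟨g, h, hg, hgdiv, hgmean, hh, hhmean, hh0, ν, v₀, v, hνpos, hνlim, hLH, hbd, ⟨E, hE⟩,
      ⟨θ, hθ, hnof, hT⟩, C, γ, hC, hγ, hrelax⟩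
    obtain ⟨Z, hZ⟩ := hS g h ν v₀ v E C γ hg hgdiv hgmean hh hhmean hh0 hνpos hνlim hLH hbd hE hC hγ
      hrelax θ hθ hnof hT
    exact stub_boundedEnstrophyNoRelaxation g h ν v₀ v C γ Z hg hgmean hh hhmean hh0 hνpos hνlim hLH hbd
      hC hγ hrelax hZ
  · intro hN g h ν v₀ v E C γ hg hgdiv hgmean hh hhmean hh0 hνpos hνlim hLH hbd hE hC hγ hrelax θ hθ
      hnof hT
    exact absurd ⟨g, h, hg, hgdiv, hgmean, hh, hhmean, hh0, ν, v₀, v, hνpos, hνlim, hLH, hbd, ⟨E, hE⟩,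
      ⟨θ, hθ, hnof, hT⟩, C, γ, hC, hγ, hrelax⟩ hN

/-! ## S4 maps the no-floor class into the no-floor-with-transfer class; the composition -/

/-- **S4 in class language.** The registered statement of `stub_slowTransferField` (first hypothesis) turns
a witness of r3 with vanishing absorbed power into a witness (the sub-family `φ` it produces; every clause
of r3 and the no-floor property pass to sub-families) with vanishing absorbed power AND slow smooth
transfer fields. [folklore] -/
theorem relaxingFamilyUnder_slowTransfer_of_noFloor
    (hS4 : ∀ (g : UnitAddTorus (Fin 2) → EuclideanSpace ℝ (Fin 2)) (h : UnitAddTorus (Fin 2) → ℝ) (ν : ℕ → ℝ)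
        (v₀ : ℕ → UnitAddTorus (Fin 2) → EuclideanSpace ℝ (Fin 2))
        (v : ℕ → ℝ → UnitAddTorus (Fin 2) → EuclideanSpace ℝ (Fin 2)) (E C γ : ℝ),
        FunctionSpaces.Torus.IsSmooth g → FunctionSpaces.Torus.IsDivFree g →
        FunctionSpaces.Torus.HasZeroMean g → FunctionSpaces.Torus.IsSmooth h →
        FunctionSpaces.Torus.HasZeroMean h → h ≠ 0 →
        (∀ j, 0 < ν j) → Tendsto ν atTop (𝓝 0) →
        (∀ j, IsGlobalLerayHopf (ν j) (fun _ => g) (v₀ j) (v j)) →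
        (∀ (j : ℕ) (T : ℝ), 0 < T →
          MemLp (FunctionSpaces.Torus.stLift (v j)) ⊤ (volume.restrict (Ioo (0 : ℝ) T ×ˢ univ))) →
        (∀ j, meanEnergy (v j) ≤ E) → 0 ≤ C → 0 < γ →
        (∀ (j : ℕ) (s : ℝ), 0 ≤ s → ∀ (T : ℝ) (ϑ : ℝ → UnitAddTorus (Fin 2) → ℝ),
          IsWeakScalarTransportOn T (ν j) (fun t => v j (s + t)) h ϑ →
            ∀ᵐ t ∂(volume.restrict (Ioo (0 : ℝ) T)),
              scalarL2Sq (ϑ t) ≤ C * Real.exp (-(γ * t)) * scalarL2Sq h) →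
        ∀ (θ : ℕ → ℝ → UnitAddTorus (Fin 2) → ℝ),
        (∀ j, IsWeakScalarTransportForced (ν j) (v j) (fun _ => h) 0 (θ j)) →
        (∀ ε : ℝ, 0 < ε → ∀ᶠ j in atTop,
          longTimeAvgSup (fun t => ν j * (eScalarGradNormSq (θ j t)).toReal) < ε) →
        ∃ φ : ℕ → ℕ, StrictMono φ ∧
          ∀ δ : ℝ, 0 < δ → ∃ (K : ℝ) (χ : ℕ → ℝ → UnitAddTorus (Fin 2) → ℝ),
            (∀ j, FunctionSpaces.Torus.IsSmoothSpaceTimeOn (Ici (0 : ℝ)) (χ j)) ∧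
            (∀ (j : ℕ) (t : ℝ), 0 ≤ t → ∀ x : UnitAddTorus (Fin 2),
              |χ j t x| ≤ K ∧ ‖FunctionSpaces.Torus.gradient (χ j t) x‖ ≤ K ∧
              (∀ i k : Fin 2,
                |FunctionSpaces.Torus.partialDeriv i (FunctionSpaces.Torus.partialDeriv k (χ j t)) x| ≤ K) ∧
              |FunctionSpaces.Torus.timeDerivWithin (Ici (0 : ℝ)) (χ j) t x| ≤ K ∧
              ‖FunctionSpaces.Torus.gradient (FunctionSpaces.Torus.timeDerivWithin (Ici (0 : ℝ)) (χ j) t) x‖ ≤ K) ∧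
            ∀ᶠ j in atTop, ∀ᶠ T in atTop,
              ∫⁻ t in Ioo (0 : ℝ) T, ∫⁻ x,
                  ‖h x - (FunctionSpaces.Torus.timeDerivWithin (Ici (0 : ℝ)) (χ j) t x +
                    ⟪v (φ j) t x, FunctionSpaces.Torus.gradient (χ j t) x⟫_ℝ)‖ₑ ^ 2
                ≤ ENNReal.ofReal (δ * T))
    (hNF : RelaxingFamilyUnder fun _g h ν v =>
      ∃ θ : ℕ → ℝ → UnitAddTorus (Fin 2) → ℝ, (∀ j, IsWeakScalarTransportForced (ν j) (v j) (fun _ => h) 0 (θ j)) ∧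
        ∀ ε : ℝ, 0 < ε → ∀ᶠ j in atTop,
          longTimeAvgSup (fun t => ν j * (eScalarGradNormSq (θ j t)).toReal) < ε) :
    RelaxingFamilyUnder fun _g h ν v =>
      ∃ θ : ℕ → ℝ → UnitAddTorus (Fin 2) → ℝ, (∀ j, IsWeakScalarTransportForced (ν j) (v j) (fun _ => h) 0 (θ j)) ∧
        (∀ ε : ℝ, 0 < ε → ∀ᶠ j in atTop,
          longTimeAvgSup (fun t => ν j * (eScalarGradNormSq (θ j t)).toReal) < ε) ∧
        (∀ δ : ℝ, 0 < δ → ∃ (K : ℝ) (χ : ℕ → ℝ → UnitAddTorus (Fin 2) → ℝ),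
          (∀ j, FunctionSpaces.Torus.IsSmoothSpaceTimeOn (Ici (0 : ℝ)) (χ j)) ∧
          (∀ (j : ℕ) (t : ℝ), 0 ≤ t → ∀ x : UnitAddTorus (Fin 2),
            |χ j t x| ≤ K ∧ ‖FunctionSpaces.Torus.gradient (χ j t) x‖ ≤ K ∧
            (∀ i k : Fin 2,
              |FunctionSpaces.Torus.partialDeriv i (FunctionSpaces.Torus.partialDeriv k (χ j t)) x| ≤ K) ∧
            |FunctionSpaces.Torus.timeDerivWithin (Ici (0 : ℝ)) (χ j) t x| ≤ K ∧
            ‖FunctionSpaces.Torus.gradient (FunctionSpaces.Torus.timeDerivWithin (Ici (0 : ℝ)) (χ j) t) x‖ ≤ K) ∧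
          ∀ᶠ j in atTop, ∀ᶠ T in atTop,
            ∫⁻ t in Ioo (0 : ℝ) T, ∫⁻ x,
                ‖h x - (FunctionSpaces.Torus.timeDerivWithin (Ici (0 : ℝ)) (χ j) t x +
                  ⟪v j t x, FunctionSpaces.Torus.gradient (χ j t) x⟫_ℝ)‖ₑ ^ 2
              ≤ ENNReal.ofReal (δ * T)) := by
  obtain ⟨g, h, hg, hgdiv, hgmean, hh, hhmean, hh0, ν, v₀, v, hνpos, hνlim, hLH, hbd, ⟨E, hE⟩,
    ⟨θ, hθ, hnof⟩, C, γ, hC, hγ, hrelax⟩ := hNF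
  obtain ⟨φ, hφ, hT⟩ :=
    hS4 g h ν v₀ v E C γ hg hgdiv hgmean hh hhmean hh0 hνpos hνlim hLH hbd hE hC hγ hrelax θ hθ hnof
  exact ⟨g, h, hg, hgdiv, hgmean, hh, hhmean, hh0, fun j => ν (φ j), fun j => v₀ (φ j),
    fun j => v (φ j), fun j => hνpos (φ j), hνlim.comp hφ.tendsto_atTop, fun j => hLH (φ j),
    fun j => hbd (φ j), ⟨E, fun j => hE (φ j)⟩,
    ⟨fun j => θ (φ j), fun j => hθ (φ j), fun ε hε => hφ.tendsto_atTop.eventually (hnof ε hε), hT⟩,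
    C, γ, hC, hγ, fun j s hs => hrelax (φ j) s hs⟩

/-- **The skeleton's composition through the classes**: S4 ∧ S3′ ⇒ `FloorUpgrade`
(`relaxingFamilyUnder_slowTransfer_of_noFloor`, `orrTiltRigidity_iff_not_relaxingFamilyUnder`,
`floorUpgrade_of_not_relaxingFamilyUnder_noFloor`). [folklore] -/
theorem floorUpgrade_of_slowTransferField_of_orrTiltRigidity
    (hS4 : ∀ (g : UnitAddTorus (Fin 2) → EuclideanSpace ℝ (Fin 2)) (h : UnitAddTorus (Fin 2) → ℝ) (ν : ℕ → ℝ)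
        (v₀ : ℕ → UnitAddTorus (Fin 2) → EuclideanSpace ℝ (Fin 2))
        (v : ℕ → ℝ → UnitAddTorus (Fin 2) → EuclideanSpace ℝ (Fin 2)) (E C γ : ℝ),
        FunctionSpaces.Torus.IsSmooth g → FunctionSpaces.Torus.IsDivFree g →
        FunctionSpaces.Torus.HasZeroMean g → FunctionSpaces.Torus.IsSmooth h →
        FunctionSpaces.Torus.HasZeroMean h → h ≠ 0 →
        (∀ j, 0 < ν j) → Tendsto ν atTop (𝓝 0) →
        (∀ j, IsGlobalLerayHopf (ν j) (fun _ => g) (v₀ j) (v j)) →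
        (∀ (j : ℕ) (T : ℝ), 0 < T →
          MemLp (FunctionSpaces.Torus.stLift (v j)) ⊤ (volume.restrict (Ioo (0 : ℝ) T ×ˢ univ))) →
        (∀ j, meanEnergy (v j) ≤ E) → 0 ≤ C → 0 < γ →
        (∀ (j : ℕ) (s : ℝ), 0 ≤ s → ∀ (T : ℝ) (ϑ : ℝ → UnitAddTorus (Fin 2) → ℝ),
          IsWeakScalarTransportOn T (ν j) (fun t => v j (s + t)) h ϑ →
            ∀ᵐ t ∂(volume.restrict (Ioo (0 : ℝ) T)),
              scalarL2Sq (ϑ t) ≤ C * Real.exp (-(γ * t)) * scalarL2Sq h) →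
        ∀ (θ : ℕ → ℝ → UnitAddTorus (Fin 2) → ℝ),
        (∀ j, IsWeakScalarTransportForced (ν j) (v j) (fun _ => h) 0 (θ j)) →
        (∀ ε : ℝ, 0 < ε → ∀ᶠ j in atTop,
          longTimeAvgSup (fun t => ν j * (eScalarGradNormSq (θ j t)).toReal) < ε) →
        ∃ φ : ℕ → ℕ, StrictMono φ ∧
          ∀ δ : ℝ, 0 < δ → ∃ (K : ℝ) (χ : ℕ → ℝ → UnitAddTorus (Fin 2) → ℝ),
            (∀ j, FunctionSpaces.Torus.IsSmoothSpaceTimeOn (Ici (0 : ℝ)) (χ j)) ∧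
            (∀ (j : ℕ) (t : ℝ), 0 ≤ t → ∀ x : UnitAddTorus (Fin 2),
              |χ j t x| ≤ K ∧ ‖FunctionSpaces.Torus.gradient (χ j t) x‖ ≤ K ∧
              (∀ i k : Fin 2,
                |FunctionSpaces.Torus.partialDeriv i (FunctionSpaces.Torus.partialDeriv k (χ j t)) x| ≤ K) ∧
              |FunctionSpaces.Torus.timeDerivWithin (Ici (0 : ℝ)) (χ j) t x| ≤ K ∧
              ‖FunctionSpaces.Torus.gradient (FunctionSpaces.Torus.timeDerivWithin (Ici (0 : ℝ)) (χ j) t) x‖ ≤ K) ∧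
            ∀ᶠ j in atTop, ∀ᶠ T in atTop,
              ∫⁻ t in Ioo (0 : ℝ) T, ∫⁻ x,
                  ‖h x - (FunctionSpaces.Torus.timeDerivWithin (Ici (0 : ℝ)) (χ j) t x +
                    ⟪v (φ j) t x, FunctionSpaces.Torus.gradient (χ j t) x⟫_ℝ)‖ₑ ^ 2
                ≤ ENNReal.ofReal (δ * T))
    (hS3 : ∀ (g : UnitAddTorus (Fin 2) → EuclideanSpace ℝ (Fin 2)) (h : UnitAddTorus (Fin 2) → ℝ) (ν : ℕ → ℝ)
        (v₀ : ℕ → UnitAddTorus (Fin 2) → EuclideanSpace ℝ (Fin 2))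
        (v : ℕ → ℝ → UnitAddTorus (Fin 2) → EuclideanSpace ℝ (Fin 2)) (E C γ : ℝ),
        FunctionSpaces.Torus.IsSmooth g → FunctionSpaces.Torus.IsDivFree g →
        FunctionSpaces.Torus.HasZeroMean g → FunctionSpaces.Torus.IsSmooth h →
        FunctionSpaces.Torus.HasZeroMean h → h ≠ 0 →
        (∀ j, 0 < ν j) → Tendsto ν atTop (𝓝 0) →
        (∀ j, IsGlobalLerayHopf (ν j) (fun _ => g) (v₀ j) (v j)) →
        (∀ (j : ℕ) (T : ℝ), 0 < T →
          MemLp (FunctionSpaces.Torus.stLift (v j)) ⊤ (volume.restrict (Ioo (0 : ℝ) T ×ˢ univ))) →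
        (∀ j, meanEnergy (v j) ≤ E) → 0 ≤ C → 0 < γ →
        (∀ (j : ℕ) (s : ℝ), 0 ≤ s → ∀ (T : ℝ) (ϑ : ℝ → UnitAddTorus (Fin 2) → ℝ),
          IsWeakScalarTransportOn T (ν j) (fun t => v j (s + t)) h ϑ →
            ∀ᵐ t ∂(volume.restrict (Ioo (0 : ℝ) T)),
              scalarL2Sq (ϑ t) ≤ C * Real.exp (-(γ * t)) * scalarL2Sq h) →
        ∀ (θ : ℕ → ℝ → UnitAddTorus (Fin 2) → ℝ),
        (∀ j, IsWeakScalarTransportForced (ν j) (v j) (fun _ => h) 0 (θ j)) →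
        (∀ ε : ℝ, 0 < ε → ∀ᶠ j in atTop,
          longTimeAvgSup (fun t => ν j * (eScalarGradNormSq (θ j t)).toReal) < ε) →
        (∀ δ : ℝ, 0 < δ → ∃ (K : ℝ) (χ : ℕ → ℝ → UnitAddTorus (Fin 2) → ℝ),
            (∀ j, FunctionSpaces.Torus.IsSmoothSpaceTimeOn (Ici (0 : ℝ)) (χ j)) ∧
            (∀ (j : ℕ) (t : ℝ), 0 ≤ t → ∀ x : UnitAddTorus (Fin 2),
              |χ j t x| ≤ K ∧ ‖FunctionSpaces.Torus.gradient (χ j t) x‖ ≤ K ∧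
              (∀ i k : Fin 2,
                |FunctionSpaces.Torus.partialDeriv i (FunctionSpaces.Torus.partialDeriv k (χ j t)) x| ≤ K) ∧
              |FunctionSpaces.Torus.timeDerivWithin (Ici (0 : ℝ)) (χ j) t x| ≤ K ∧
              ‖FunctionSpaces.Torus.gradient (FunctionSpaces.Torus.timeDerivWithin (Ici (0 : ℝ)) (χ j) t) x‖ ≤ K) ∧
            ∀ᶠ j in atTop, ∀ᶠ T in atTop,
              ∫⁻ t in Ioo (0 : ℝ) T, ∫⁻ x,
                  ‖h x - (FunctionSpaces.Torus.timeDerivWithin (Ici (0 : ℝ)) (χ j) t x +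
                    ⟪v j t x, FunctionSpaces.Torus.gradient (χ j t) x⟫_ℝ)‖ₑ ^ 2
                ≤ ENNReal.ofReal (δ * T)) →
        ∃ Z : ℝ, ∃ᶠ j in atTop, ∀ᶠ T in atTop,
          ∫⁻ t in Ioo (0 : ℝ) T, FunctionSpaces.Torus.eGradNormSq (v j t) ≤ ENNReal.ofReal (Z * T)) :
    FloorUpgrade :=
  floorUpgrade_of_not_relaxingFamilyUnder_noFloor fun hNF =>
    (orrTiltRigidity_iff_not_relaxingFamilyUnder.1 hS3) (relaxingFamilyUnder_slowTransfer_of_noFloor hS4 hNF)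

end Summit.AnomalousDissipation.AnomalousDissipation.Theorems.FloorUpgradeMDD

end
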